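import Literature.Computability.Complexity.CodeFPBudgets
import HarnessLib

/-!
# Typed polynomial time on codes: least labels of an equivalence closure (naive union–find)

Trunk `CplxCore`, a component above the typed polynomial-time algebra `CodeFP`
(`CodeFP.lean`, `CodeFPArith.lean`, `CodeFPBudgets.lean`). Gadget reductions between constraint
satisfaction problems IDENTIFY variables along the equality atoms of the gadgets (Bulatov–Jeavons–
Krokhin; first client: the discharge of
`Literature.ModelTheory.FiniteModelTheory.cspLanguage_karpReducible_of_ppConstructs`, Barto–Opršal–
Pinsker, *The wonderland of reflections*, Prop. 3.1 / Cor. 3.5). On codes this is the computation,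
for a list `E` of pairs of naturals (edges) on the vertices `0, …, N - 1`, of the LEAST ELEMENT OF
THE CLASS of every vertex in the equivalence relation generated by `E` (Mathlib
`Relation.EqvGen`). This file provides

* `MinLabel.classMin E u` — the least `x` with `EqvGen (Adj E) x u` (`Nat.find`), with its API
  (`eqvGen_classMin`, `classMin_le`, `classMin_eq_of_eqvGen`, `classMin_eq_iff`, `classMin_lt`);
* the naive label-propagation algorithm `MinLabel.minLabels E N = (relax E)^[N ^ 2] [0, …, N-1]`
  (every round, every vertex takes the least label among its own and its neighbours'), and its
  correctness `MinLabel.getD_minLabels`: for edges inside `[0, N)` the label of `u < N` is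
  `classMin E u`. The proof is by STABILISATION, not by path lengths: labels only decrease, the
  potential `Σ labels ≤ N²` drops in every round that changes something, a round that changes
  nothing is a fixpoint forever, so after `N²` rounds the labelling is a fixpoint; a fixpoint is
  constant along edges, hence along classes, and every label is a member of the class bounded by
  the vertex itself — so it is the least member;
* `MinLabel.codeFP_minLabels`: the algorithm is typed polynomial time
  (`CodeFP (pairE (rawE (pairE natE natE)) unE) (rawE natE)`, the number of vertices in unary).

## References

* S. Arora, B. Barak, *Computational Complexity: A Modern Approach*, CUP 2009, §1.3 (closure of
  polynomial time under composition and polynomially bounded loops).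
* A. Bulatov, P. Jeavons, A. Krokhin, *Classifying the complexity of constraints using finite
  algebras*, SIAM J. Comput. 34 (2005), §2 (gadget reductions identify variables).
-/

namespace Literature.Computability.Complexity

open _root_.Relation Polynomial

namespace MinLabel

/-! ### The least element of a class -/

section ClassMin

variable (E : List (ℕ × ℕ))

/-- The relation listed by the edge list `E`. [folklore] -/
def Adj (a b : ℕ) : Prop := (a, b) ∈ E

/-- Every class is inhabited by its vertex. [folklore] -/
theorem exists_eqvGen (u : ℕ) : ∃ x, EqvGen (Adj E) x u := ⟨u, EqvGen.refl u⟩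

/-- **The least element of the class of `u`** in the equivalence relation generated by the edges
`E`. [folklore] -/
noncomputable def classMin (u : ℕ) : ℕ := @Nat.find _ (Classical.decPred _) (exists_eqvGen E u)

/-- `classMin E u` lies in the class of `u`. [folklore] -/
theorem eqvGen_classMin (u : ℕ) : EqvGen (Adj E) (classMin E u) u :=
  @Nat.find_spec _ (Classical.decPred _) (exists_eqvGen E u)

/-- `classMin E u` is below every member of the class of `u`. [folklore] -/
theorem classMin_le {x u : ℕ} (h : EqvGen (Adj E) x u) : classMin E u ≤ x :=
  @Nat.find_min' _ (Classical.decPred _) (exists_eqvGen E u) _ h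

/-- `classMin E u ≤ u`. [folklore] -/
theorem classMin_le_self (u : ℕ) : classMin E u ≤ u := classMin_le E (EqvGen.refl u)

/-- Related vertices have the same least element. [folklore] -/
theorem classMin_eq_of_eqvGen {u v : ℕ} (h : EqvGen (Adj E) u v) : classMin E u = classMin E v :=
  le_antisymm (classMin_le E (EqvGen.trans _ _ _ (eqvGen_classMin E v) (EqvGen.symm _ _ h)))
    (classMin_le E (EqvGen.trans _ _ _ (eqvGen_classMin E u) h))

/-- The endpoints of an edge have the same least element. [folklore] -/
theorem classMin_eq_of_mem {a b : ℕ} (h : (a, b) ∈ E) : classMin E a = classMin E b :=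
  classMin_eq_of_eqvGen E (EqvGen.rel _ _ h)

/-- Characterization of `classMin E u`: the member of the class below all members. [folklore] -/
theorem classMin_eq_iff {u x : ℕ} :
    classMin E u = x ↔ EqvGen (Adj E) x u ∧ ∀ y, EqvGen (Adj E) y u → x ≤ y := by
  constructor
  · rintro rfl
    exact ⟨eqvGen_classMin E u, fun y hy => classMin_le E hy⟩
  · rintro ⟨hx, hmin⟩
    exact le_antisymm (classMin_le E hx) (hmin _ (eqvGen_classMin E u))

/-- Two related vertices are equal or both endpoints of edges. [folklore] -/
theorem eq_or_endpoints_of_eqvGen {x y : ℕ} (h : EqvGen (Adj E) x y) :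
    x = y ∨ ((∃ e ∈ E, x = e.1 ∨ x = e.2) ∧ (∃ e ∈ E, y = e.1 ∨ y = e.2)) := by
  induction h with
  | rel a b hab => exact Or.inr ⟨⟨(a, b), hab, Or.inl rfl⟩, ⟨(a, b), hab, Or.inr rfl⟩⟩
  | refl a => exact Or.inl rfl
  | symm a b _ ih =>
    rcases ih with rfl | ⟨ha, hb⟩
    · exact Or.inl rfl
    · exact Or.inr ⟨hb, ha⟩
  | trans a b c _ _ ih₁ ih₂ =>
    rcases ih₁ with rfl | ⟨ha, hb⟩
    · exact ih₂
    · rcases ih₂ with rfl | ⟨-, hc⟩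
      · exact Or.inr ⟨ha, hb⟩
      · exact Or.inr ⟨ha, hc⟩

/-- With all edges inside `[0, N)`, two related vertices are equal or both below `N`. [folklore] -/
theorem eq_or_lt_of_eqvGen {N : ℕ} (hE : ∀ e ∈ E, e.1 < N ∧ e.2 < N) {x y : ℕ}
    (h : EqvGen (Adj E) x y) : x = y ∨ (x < N ∧ y < N) := by
  rcases eq_or_endpoints_of_eqvGen E h with rfl | ⟨⟨e, he, hx⟩, ⟨e', he', hy⟩⟩
  · exact Or.inl rfl
  · refine Or.inr ⟨?_, ?_⟩
    · rcases hx with rfl | rfl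
      · exact (hE e he).1
      · exact (hE e he).2
    · rcases hy with rfl | rfl
      · exact (hE e' he').1
      · exact (hE e' he').2

/-- With all edges inside `[0, N)`, `classMin E u < N` for `u < N`. [folklore] -/
theorem classMin_lt {N : ℕ} (hE : ∀ e ∈ E, e.1 < N ∧ e.2 < N) {u : ℕ} (hu : u < N) :
    classMin E u < N := by
  rcases eq_or_lt_of_eqvGen E hE (eqvGen_classMin E u) with h | h
  · rw [h]; exact hu
  · exact h.1

end ClassMin

/-! ### The label-propagation algorithm -/

section Algorithm

variable (E : List (ℕ × ℕ))

/-- The fold step at vertex `u`: lower the running label by the label of a neighbour along the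
edge `e`. [folklore] -/
def step (L : List ℕ) (u : ℕ) (acc : ℕ) (e : ℕ × ℕ) : ℕ :=
  if e.1 = u then min acc (L.getD e.2 0) else if e.2 = u then min acc (L.getD e.1 0) else acc

/-- The new label of `u`: the least label among its own and its neighbours'. [folklore] -/
def relaxAt (L : List ℕ) (u : ℕ) : ℕ := E.foldl (fun acc e => step L u acc e) (L.getD u 0)

/-- One round: every vertex is relabelled. [folklore] -/
def relax (L : List ℕ) : List ℕ := (List.range L.length).map fun u => relaxAt E L u

/-- **The least-label algorithm**: `N²` rounds of relaxation from the identity labelling.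
[folklore] -/
def minLabels (N : ℕ) : List ℕ := (relax E)^[N ^ 2] (List.range N)

/-- The step never increases the running label. [folklore] -/
theorem step_le (L : List ℕ) (u acc : ℕ) (e : ℕ × ℕ) : step L u acc e ≤ acc := by
  unfold step
  split_ifs <;> simp

/-- The fold never increases the running label. [folklore] -/
theorem foldl_step_le (L : List ℕ) (u : ℕ) : ∀ (E' : List (ℕ × ℕ)) (acc : ℕ),
    E'.foldl (fun acc e => step L u acc e) acc ≤ acc
  | [], _ => le_rfl
  | e :: E', acc => (foldl_step_le L u E' _).trans (step_le L u acc e)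

/-- The fold ends below the label across every edge leaving `u`. [folklore] -/
theorem foldl_step_le_fst (L : List ℕ) (u : ℕ) : ∀ (E' : List (ℕ × ℕ)) (acc : ℕ) (e : ℕ × ℕ),
    e ∈ E' → e.1 = u → E'.foldl (fun acc e => step L u acc e) acc ≤ L.getD e.2 0
  | [], _, _, he, _ => absurd he List.not_mem_nil
  | e' :: E', acc, e, he, hu => by
    rw [List.foldl_cons]
    rcases List.mem_cons.1 he with rfl | he
    · refine (foldl_step_le L u E' _).trans ?_
      rw [step, if_pos hu]
      exact min_le_right _ _
    · exact foldl_step_le_fst L u E' _ e he hu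

/-- The fold ends below the label across every edge entering `u`. [folklore] -/
theorem foldl_step_le_snd (L : List ℕ) (u : ℕ) : ∀ (E' : List (ℕ × ℕ)) (acc : ℕ) (e : ℕ × ℕ),
    e ∈ E' → e.2 = u → E'.foldl (fun acc e => step L u acc e) acc ≤ L.getD e.1 0
  | [], _, _, he, _ => absurd he List.not_mem_nil
  | e' :: E', acc, e, he, hu => by
    rw [List.foldl_cons]
    rcases List.mem_cons.1 he with rfl | he
    · refine (foldl_step_le L u E' _).trans ?_
      unfold step
      by_cases h1 : e.1 = u
      · rw [if_pos h1, hu, h1]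
        exact min_le_right _ _
      · rw [if_neg h1, if_pos hu]
        exact min_le_right _ _
    · exact foldl_step_le_snd L u E' _ e he hu

/-- The fold ends at the initial label or at the label of a neighbour. [folklore] -/
theorem foldl_step_mem (L : List ℕ) (u : ℕ) : ∀ (E' : List (ℕ × ℕ)) (acc : ℕ),
    E'.foldl (fun acc e => step L u acc e) acc = acc ∨
      ∃ e ∈ E', (e.1 = u ∧ E'.foldl (fun acc e => step L u acc e) acc = L.getD e.2 0) ∨
        (e.2 = u ∧ E'.foldl (fun acc e => step L u acc e) acc = L.getD e.1 0)
  | [], _ => Or.inl rfl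
  | e :: E', acc => by
    rw [List.foldl_cons]
    rcases foldl_step_mem L u E' (step L u acc e) with h | ⟨e', he', h⟩
    · rw [h]
      unfold step
      by_cases h1 : e.1 = u
      · rw [if_pos h1]
        rcases min_choice acc (L.getD e.2 0) with h' | h'
        · exact Or.inl h'
        · exact Or.inr ⟨e, List.mem_cons_self .., Or.inl ⟨h1, h'⟩⟩
      · rw [if_neg h1]
        by_cases h2 : e.2 = u
        · rw [if_pos h2]
          rcases min_choice acc (L.getD e.1 0) with h' | h'
          · exact Or.inl h'
          · exact Or.inr ⟨e, List.mem_cons_self .., Or.inr ⟨h2, h'⟩⟩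
        · rw [if_neg h2]
          exact Or.inl rfl
    · exact Or.inr ⟨e', List.mem_cons_of_mem _ he', h⟩

/-- The new label is at most the old one. [folklore] -/
theorem relaxAt_le (L : List ℕ) (u : ℕ) : relaxAt E L u ≤ L.getD u 0 := foldl_step_le L u E _

/-- A round keeps the number of labels. [folklore] -/
@[simp] theorem length_relax (L : List ℕ) : (relax E L).length = L.length := by
  simp [relax]

/-- The labels of a round. [folklore] -/
theorem getD_relax (L : List ℕ) {u : ℕ} (hu : u < L.length) : (relax E L).getD u 0 = relaxAt E L u := by
  rw [relax, List.getD_eq_getElem _ _ (by simpa using hu), List.getElem_map, List.getElem_range]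

/-- Iterated rounds keep the number of labels. [folklore] -/
@[simp] theorem length_iterate_relax (t : ℕ) (L : List ℕ) : ((relax E)^[t] L).length = L.length := by
  induction t with
  | zero => rfl
  | succ t ih => rw [Function.iterate_succ_apply', length_relax, ih]

/-- **Labels only decrease and start at the identity**: after any number of rounds the label of
`u < N` is at most `u`. [folklore] -/
theorem getD_iterate_relax_le (N : ℕ) : ∀ (t : ℕ) {u : ℕ}, u < N →
    ((relax E)^[t] (List.range N)).getD u 0 ≤ u
  | 0, u, hu => by
    simp only [Function.iterate_zero, id_eq]
    rw [List.getD_eq_getElem _ _ (by simpa using hu), List.getElem_range]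
  | t + 1, u, hu => by
    rw [Function.iterate_succ_apply', getD_relax E _ (by simpa using hu)]
    exact (relaxAt_le E _ u).trans (getD_iterate_relax_le N t hu)

/-- **Every label lies in the class of its vertex** (edges inside `[0, N)`). [folklore] -/
theorem eqvGen_getD_iterate_relax {N : ℕ} (hE : ∀ e ∈ E, e.1 < N ∧ e.2 < N) :
    ∀ (t : ℕ) {u : ℕ}, u < N → EqvGen (Adj E) (((relax E)^[t] (List.range N)).getD u 0) u
  | 0, u, hu => by
    simp only [Function.iterate_zero, id_eq]
    rw [List.getD_eq_getElem _ _ (by simpa using hu), List.getElem_range]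
    exact EqvGen.refl u
  | t + 1, u, hu => by
    rw [Function.iterate_succ_apply', getD_relax E _ (by simpa using hu)]
    set L := (relax E)^[t] (List.range N) with hL
    rcases foldl_step_mem L u E (L.getD u 0) with h | ⟨e, he, ⟨h1, h⟩ | ⟨h2, h⟩⟩
    · rw [relaxAt, h]
      exact eqvGen_getD_iterate_relax hE t hu
    · rw [relaxAt, h]
      refine EqvGen.trans _ _ _ (eqvGen_getD_iterate_relax hE t (hE e he).2) ?_
      rw [← h1]
      exact EqvGen.symm _ _ (EqvGen.rel _ _ (show (e.1, e.2) ∈ E from he))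
    · rw [relaxAt, h]
      refine EqvGen.trans _ _ _ (eqvGen_getD_iterate_relax hE t (hE e he).1) ?_
      rw [← h2]
      exact EqvGen.rel _ _ (show (e.1, e.2) ∈ E from he)

/-- Sums of pointwise comparable lists of the same length compare, strictly if they differ.
[folklore] -/
theorem sum_lt_sum_of_ne : ∀ (l₁ l₂ : List ℕ), l₁.length = l₂.length →
    (∀ i, l₁.getD i 0 ≤ l₂.getD i 0) → (l₁.sum ≤ l₂.sum ∧ (l₁ ≠ l₂ → l₁.sum < l₂.sum))
  | [], [], _, _ => ⟨le_rfl, fun h => absurd rfl h⟩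
  | [], _ :: _, h, _ => absurd h (by simp)
  | _ :: _, [], h, _ => absurd h (by simp)
  | a :: l₁, b :: l₂, hlen, hle => by
    have hab : a ≤ b := by simpa using hle 0
    have htl : ∀ i, l₁.getD i 0 ≤ l₂.getD i 0 := fun i => by simpa using hle (i + 1)
    obtain ⟨ih₁, ih₂⟩ := sum_lt_sum_of_ne l₁ l₂ (by simpa using hlen) htl
    refine ⟨by simp only [List.sum_cons]; omega, fun hne => ?_⟩
    simp only [List.sum_cons]
    by_cases h : a = b
    · subst h
      have : l₁ ≠ l₂ := fun h' => hne (by rw [h'])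
      have := ih₂ this
      omega
    · omega

/-- A round lowers the potential `Σ labels`, strictly unless it is a fixpoint. [folklore] -/
theorem sum_relax_lt (L : List ℕ) (h : relax E L ≠ L) : (relax E L).sum < L.sum := by
  refine (sum_lt_sum_of_ne (relax E L) L (length_relax E L) fun i => ?_).2 h
  by_cases hi : i < L.length
  · rw [getD_relax E L hi]
    exact relaxAt_le E L i
  · push Not at hi
    rw [List.getD_eq_default _ _ (by simpa using hi), List.getD_eq_default _ _ hi]

/-- A fixpoint stays fixed. [folklore] -/
theorem iterate_relax_fixed {L : List ℕ} (h : relax E L = L) (k : ℕ) : (relax E)^[k] L = L :=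
  Function.iterate_fixed h k

/-- **Stabilisation**: after `N²` rounds from the identity labelling on `N` vertices the labelling
is a fixpoint (the potential `Σ labels ≤ N²` drops in every earlier round otherwise). [folklore] -/
theorem relax_minLabels (N : ℕ) : relax E (minLabels E N) = minLabels E N := by
  by_contra hne
  -- `L t`: the labelling after `t` rounds
  let L : ℕ → List ℕ := fun t => (relax E)^[t] (List.range N)
  have hLsucc : ∀ t, L (t + 1) = relax E (L t) := fun t => Function.iterate_succ_apply' _ _ _
  have hLN : L (N ^ 2) = minLabels E N := rfl
  -- no earlier fixpoint
  have hnofix : ∀ t ≤ N ^ 2, relax E (L t) ≠ L t := by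
    intro t ht hfix
    apply hne
    obtain ⟨k, hk⟩ := Nat.exists_eq_add_of_le ht
    have h1 : minLabels E N = L t := by
      rw [← hLN, hk]
      change (relax E)^[t + k] (List.range N) = L t
      rw [add_comm, Function.iterate_add_apply]
      exact iterate_relax_fixed E hfix k
    rw [h1, hfix]
  -- the potential drops by one every round
  have hdrop : ∀ t ≤ N ^ 2 + 1, (L t).sum + t ≤ (L 0).sum := by
    intro t
    induction t with
    | zero => intro; simp
    | succ t ih =>
      intro ht
      have h1 := ih (by omega)
      have h2 : (L (t + 1)).sum < (L t).sum := by
        rw [hLsucc]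
        exact sum_relax_lt E (L t) (hnofix t (by omega))
      omega
  have hinit : (L 0).sum ≤ N ^ 2 := by
    change (List.range N).sum ≤ N ^ 2
    calc (List.range N).sum ≤ (List.range N).length • N :=
          List.sum_le_card_nsmul _ _ fun x hx => (List.mem_range.1 hx).le
      _ = N ^ 2 := by rw [List.length_range, smul_eq_mul, sq]
  have := hdrop (N ^ 2 + 1) le_rfl
  omega

/-- The number of labels is `N`. [folklore] -/
@[simp] theorem length_minLabels (N : ℕ) : (minLabels E N).length = N := by
  rw [minLabels, length_iterate_relax, List.length_range]

/-- **A fixpoint is constant along edges.** [folklore] -/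
theorem getD_minLabels_eq_of_mem {N : ℕ} (hE : ∀ e ∈ E, e.1 < N ∧ e.2 < N) {a b : ℕ}
    (h : (a, b) ∈ E) : (minLabels E N).getD a 0 = (minLabels E N).getD b 0 := by
  have hfix := relax_minLabels E N
  have ha : (minLabels E N).getD a 0 = relaxAt E (minLabels E N) a := by
    conv_lhs => rw [← hfix]
    exact getD_relax E _ (by rw [length_minLabels]; exact (hE _ h).1)
  have hb : (minLabels E N).getD b 0 = relaxAt E (minLabels E N) b := by
    conv_lhs => rw [← hfix]
    exact getD_relax E _ (by rw [length_minLabels]; exact (hE _ h).2)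
  apply le_antisymm
  · rw [ha]
    exact foldl_step_le_fst (minLabels E N) a E _ (a, b) h rfl
  · rw [hb]
    exact foldl_step_le_snd (minLabels E N) b E _ (a, b) h rfl

/-- A fixpoint is constant along classes. [folklore] -/
theorem getD_minLabels_eq_of_eqvGen {N : ℕ} (hE : ∀ e ∈ E, e.1 < N ∧ e.2 < N) {x y : ℕ}
    (h : EqvGen (Adj E) x y) : (minLabels E N).getD x 0 = (minLabels E N).getD y 0 := by
  induction h with
  | rel a b hab => exact getD_minLabels_eq_of_mem E hE hab
  | refl a => rfl
  | symm a b _ ih => exact ih.symm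
  | trans a b c _ _ ih₁ ih₂ => exact ih₁.trans ih₂

/-- **Correctness of the least-label algorithm**: with all edges inside `[0, N)`, the label of
`u < N` after `N²` rounds is the least element of the class of `u`. [folklore] -/
theorem getD_minLabels {N : ℕ} (hE : ∀ e ∈ E, e.1 < N ∧ e.2 < N) {u : ℕ} (hu : u < N) (d : ℕ) :
    (minLabels E N).getD u d = classMin E u := by
  have hd : (minLabels E N).getD u d = (minLabels E N).getD u 0 := by
    rw [List.getD_eq_getElem _ _ (by simpa using hu), List.getD_eq_getElem _ _ (by simpa using hu)]
  rw [hd, eq_comm, classMin_eq_iff]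
  refine ⟨eqvGen_getD_iterate_relax E hE _ hu, fun y hy => ?_⟩
  rw [← getD_minLabels_eq_of_eqvGen E hE hy]
  rcases eq_or_lt_of_eqvGen E hE hy with rfl | ⟨hy', -⟩
  · exact getD_iterate_relax_le E N _ hu
  · exact getD_iterate_relax_le E N _ hy'

/-- The labels are below `N`. [folklore] -/
theorem getD_minLabels_lt {N : ℕ} {u : ℕ} (hu : u < N) (d : ℕ) : (minLabels E N).getD u d < N := by
  have hd : (minLabels E N).getD u d = (minLabels E N).getD u 0 := by
    rw [List.getD_eq_getElem _ _ (by simpa using hu), List.getD_eq_getElem _ _ (by simpa using hu)]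
  rw [hd]
  exact lt_of_le_of_lt (getD_iterate_relax_le E N _ hu) hu

end Algorithm

/-! ### The algorithm is typed polynomial time -/

section Code

open CodeFP

/-- Iterating along a fuel list of units is a `foldl` (twin of `CodeFP.foldl_units_eq_iterate` of
`CodeFPListKit.lean`, whose treewidth imports are not wanted here). [folklore] -/
theorem foldl_units_eq_iterate {β : Type} (F : β → β) (n : ℕ) (s₀ : β) :
    (List.replicate n ()).foldl (fun s _ => F s) s₀ = F^[n] s₀ := by
  induction n generalizing s₀ with
  | zero => rfl
  | succ n ih => rw [List.replicate_succ, List.foldl_cons, ih, Function.iterate_succ_apply]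

/-- A raw list of numerals below a bound is short: `|rawE natE L| ≤ |L| · (2B + 2)` if every item
is `≤ B`. [folklore] -/
theorem length_rawE_natE_le {L : List ℕ} {B : ℕ} (h : ∀ x ∈ L, x ≤ B) :
    (rawE natE L).length ≤ L.length * (2 * B + 2) := by
  rw [length_rawE]
  calc (L.map fun a => 2 * (natE a).length + 2).sum
      ≤ (L.map fun a => 2 * (natE a).length + 2).length • (2 * B + 2) :=
        List.sum_le_card_nsmul _ _ fun x hx => by
          obtain ⟨a, ha, rfl⟩ := List.mem_map.1 hx
          have h1 := length_natE_le a
          have h2 := h a ha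
          omega
    _ = L.length * (2 * B + 2) := by rw [List.length_map, smul_eq_mul]

/-- An item of a raw list of numerals is short: `|natE (L.getD u 0)| ≤ |rawE natE L|`. [folklore] -/
theorem length_natE_getD_le (L : List ℕ) (u : ℕ) : (natE (L.getD u 0)).length ≤ (rawE natE L).length := by
  by_cases hu : u < L.length
  · have hmem : L.getD u 0 ∈ L := by
      rw [List.getD_eq_getElem _ _ hu]; exact List.getElem_mem hu
    have := length_item_le_length_rawE natE hmem
    omega
  · push Not at hu
    rw [List.getD_eq_default _ _ hu]
    simp

/-- The fold step on codes (context `(L, u)`, item `e`, accumulator). [cite: AroraBarak2009, §1.3] -/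
theorem codeFP_step : CodeFP (pairE (pairE (rawE natE) natE) (pairE (pairE natE natE) natE)) natE
    (fun t => step t.1.1 t.1.2 t.2.2 t.2.1) := by
  let cE : (List ℕ × ℕ) × (ℕ × ℕ) × ℕ → List Bool :=
    pairE (pairE (rawE natE) natE) (pairE (pairE natE natE) natE)
  have hL : CodeFP cE (rawE natE) (fun t => t.1.1) := (fst _ _).fst'
  have hu : CodeFP cE natE (fun t => t.1.2) := (fst _ _).snd'
  have he1 : CodeFP cE natE (fun t => t.2.1.1) := (snd _ _).fst'.fst'
  have he2 : CodeFP cE natE (fun t => t.2.1.2) := (snd _ _).fst'.snd'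
  have hacc : CodeFP cE natE (fun t => t.2.2) := (snd _ _).snd'
  have hget1 : CodeFP cE natE (fun t => t.1.1.getD t.2.1.1 0) := (rawGetD natE (d := 0) rfl).comp (hL.pair he1)
  have hget2 : CodeFP cE natE (fun t => t.1.1.getD t.2.1.2 0) := (rawGetD natE (d := 0) rfl).comp (hL.pair he2)
  have ht1 : CodeFP cE bitE (fun t => decide (t.2.1.1 = t.1.2)) := natEq.comp (he1.pair hu)
  have ht2 : CodeFP cE bitE (fun t => decide (t.2.1.2 = t.1.2)) := natEq.comp (he2.pair hu)
  refine ((ht1.ite (natMin.comp (hacc.pair hget2)) (ht2.ite (natMin.comp (hacc.pair hget1)) hacc)).congr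
    fun t => ?_)
  simp only [step, decide_eq_true_eq]

/-- `relaxAt` on codes (context `(L, u)`, the edge list folded). [cite: AroraBarak2009, §1.3] -/
theorem codeFP_relaxAt : CodeFP (pairE (pairE (rawE natE) natE) (rawE (pairE natE natE))) natE
    (fun p => relaxAt p.2 p.1.1 p.1.2) := by
  have hinit : CodeFP (pairE (rawE natE) natE) natE (fun c => c.1.getD c.2 0) := rawGetD natE (d := 0) rfl
  have h := foldl (σ := List ℕ × ℕ) (α := ℕ × ℕ) (β := ℕ) (eσ := pairE (rawE natE) natE)
    (eα := pairE natE natE) (eβ := natE) (step := fun c e acc => step c.1 c.2 acc e)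
    (init := fun c => c.1.getD c.2 0) codeFP_step hinit X (fun c l₁ l₂ => by
      rw [eval_X]
      refine le_trans ?_ (le_trans (length_natE_getD_le c.1 c.2) ?_)
      · rw [length_natE, length_natE]
        exact Nat.size_le_size (foldl_step_le c.1 c.2 l₁ _)
      · simp only [pairE_apply, length_boolPair]
        omega)
  exact h.congr fun p => rfl

/-- One round on codes. [cite: AroraBarak2009, §1.3] -/
theorem codeFP_relax : CodeFP (pairE (rawE (pairE natE natE)) (rawE natE)) (rawE natE)
    (fun p => relax p.1 p.2) := by
  let cE : List (ℕ × ℕ) × List ℕ → List Bool := pairE (rawE (pairE natE natE)) (rawE natE)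
  have hitem : CodeFP (pairE cE natE) natE (fun q => relaxAt q.1.1 q.1.2 q.2) :=
    codeFP_relaxAt.comp (((fst _ _).snd'.pair (snd _ _)).pair (fst _ _).fst')
  have hrange : CodeFP cE (rawE natE) (fun p => List.range p.2.length) := urange.comp ((ulength natE).comp (snd _ _))
  exact ((map hitem).comp ((CodeFP.id cE).pair hrange)).congr fun p => rfl

/-- **The least-label algorithm is typed polynomial time** (edge list, number of vertices in
unary). [cite: AroraBarak2009, §1.3 (polynomially bounded loops)] -/
theorem codeFP_minLabels : CodeFP (pairE (rawE (pairE natE natE)) unE) (rawE natE)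
    (fun p => minLabels p.1 p.2) := by
  let σE : List (ℕ × ℕ) × ℕ → List Bool := pairE (rawE (pairE natE natE)) unE
  have hstep : CodeFP (pairE σE (pairE unitE (rawE natE))) (rawE natE) (fun t => relax t.1.1 t.2.2) :=
    codeFP_relax.comp ((fst _ _).fst'.pair (snd _ _).snd')
  have hinit : CodeFP σE (rawE natE) (fun s => List.range s.2) := urange.comp (snd _ _)
  have h := foldl (σ := List (ℕ × ℕ) × ℕ) (α := Unit) (β := List ℕ) (eσ := σE) (eα := unitE)
    (eβ := rawE natE) (step := fun s _ L => relax s.1 L) (init := fun s => List.range s.2) hstep hinit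
    (X * (2 * X + 2)) (fun s l₁ l₂ => by
      obtain ⟨E, N⟩ := s
      have hfold : l₁.foldl (fun b (_ : Unit) => relax E b) (List.range N) =
          (relax E)^[l₁.length] (List.range N) := by
        rw [eq_replicate_unit l₁, foldl_units_eq_iterate, List.length_replicate]
      change (rawE natE (l₁.foldl (fun b (_ : Unit) => relax E b) (List.range N))).length ≤ _
      rw [hfold]
      have hlen : ((relax E)^[l₁.length] (List.range N)).length = N := by
        rw [length_iterate_relax, List.length_range]
      have hB : ∀ x ∈ (relax E)^[l₁.length] (List.range N), x ≤ N := by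
        intro x hx
        obtain ⟨i, hi, rfl⟩ := List.getElem_of_mem hx
        have hi' : i < N := by rw [← hlen]; exact hi
        have h := getD_iterate_relax_le E N l₁.length hi'
        rw [List.getD_eq_getElem _ _ hi] at h
        exact h.trans hi'.le
      refine (length_rawE_natE_le hB).trans ?_
      rw [hlen]
      simp only [eval_mul, eval_add, eval_X, eval_ofNat]
      have hN : N ≤ (pairE σE (rawE unitE) ((E, N), l₁ ++ l₂)).length := by
        simp only [pairE_apply, length_boolPair, length_unE, σE]
        omega
      exact Nat.mul_le_mul hN (by omega))
  refine ((h.comp ((CodeFP.id σE).pair ((unitsPow 2).comp (snd _ _)))).congr fun p => ?_)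
  obtain ⟨E, N⟩ := p
  exact foldl_units_eq_iterate (relax E) (N ^ 2) (List.range N)

end Code

end MinLabel

end Literature.Computability.Complexity
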